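import Mathlib
import Literature.Analysis.FluidPDE.AxisymmetricEuler
import Literature.Analysis.FluidPDE.SwirlTransportProofs
import Literature.Analysis.FluidPDE.AxisymVorticityAlgebra
import Literature.Analysis.FluidPDE.LeraySeparationOfEnergyTools
import Literature.Analysis.FluidPDE.VectorCalculus
import HarnessLib

/-!
# Crux `EulerZoomLiouville.PowerGaugeEulerLiouville` (stmt-NavierStokesRegularity-19832), line `swirl-capacity`, stub D2′:
# THE SWIRL CAPACITY FLOOR FOLLOWS FROM THE AXIS CAPACITY FLOOR (`stub_swirlCapacityFloor`, signature unfolded)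

Route №10 `EulerZoomLiouville` (NavierStokesRegularity), crux E.  Line `swirl-capacity` (ideator ns-idea-11 g3;
`Cruxes/PowerGaugeEulerLiouville/Lines/swirl_capacity.lean`), registered stub `stub_swirlCapacityFloor` (D2′, «S/M−»):
`AxisCapacityFloor → SwirlCapacityFloor`, proved here with both `def`s of the Cruxes file δ-UNFOLDED (so the skeleton fills the stub by
`exact`).  Seat ns-ezl-w3 (default pick after W-PF1/A2; D1/D3 are ns-sfl-p1's, D2 — the lever itself — is NOT claimed here).

THE STATEMENT.  IF every axisymmetric `C¹` scalar `f` vanishing on the axis with `f ≥ γ₀` on a measurable `T ⊆ B(0,A)` of volume `≥ V` has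
`∫_{B(0,3A)} |∇f|²/r² ≥ K γ₀²/(A(1 + log⁺(A³/V)))` (the AXIS CAPACITY FLOOR, hypothesis), THEN every axisymmetric `C¹` FIELD `v` with
`|Γ| = |swirl v| ≥ γ₀` on such a `T` has `∫_{B(0,3A)} ‖∇v‖_F² ≥ K′ γ₀²/(A(1 + log⁺(A³/V)))`, `K′ = K/(4(1 + log 2))`.

THE PROOF.  (1) SIGN SPLIT: `T ⊆ (T ∩ {Γ ≥ γ₀}) ∪ (T ∩ {−Γ ≥ γ₀})`, so one half has volume `≥ V/2`; `f = ±Γ` is a `C¹` axisymmetric scalar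
vanishing on the axis (tree: `contDiff_swirl`, `IsAxisymmetric.swirl_rotZ`, `swirl_eq_zero_of_cylRadius_eq_zero`).  (2) THE POINTWISE LEVER
`‖∇Γ(x)‖ ≤ 2 r ‖∇v(x)‖` (`norm_fderiv_swirl_le`): `DΓ(x)h = ⟪Jx, Dv(x)h⟫ + ⟪Jh, v(x)⟫` (tree `fderiv_swirl_apply`), `⟪Jh, v⟫ = −⟪Jv, h⟫`, and the
infinitesimal axisymmetry `J v(x) = Dv(x)(Jx)` (tree `IsAxisymmetric.fderiv_rotGen`), with `‖Jx‖ = r`; hence `‖∇f‖²/r² ≤ 4‖∇v‖² ≤ 4‖∇v‖_F²`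
(tree `norm_sq_le_frobeniusNormSq`).  (3) The hypothesis at volume `V/2` and `log⁺(2A³/V) ≤ log 2 + log⁺(A³/V) ≤ (1 + log 2)(1 + log⁺(A³/V)) − 1`.

* `norm_fderiv_swirl_le`, `norm_fderiv_swirl_sq_div_le` — the pointwise lever;
* **`swirlCapacityFloor_of_axisCapacityFloor`** — the stub signature, unfolded.

WHAT THIS IS NOT: not NS, not the crux, and NOT the lever D2 (`AxisCapacityFloor` stays a hypothesis here and an OPEN stub of the line) — a
helper `--supports` stmt-19832; 19832 is a crux CLASS of Euler/NS strata and stays OPEN; nothing here bears on NS regularity. [folklore]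
-/

noncomputable section

-- flat `Theorems/<Route><Decl>…` files of one crux share the namespace of the crux (tree convention)
set_option linter.dupNamespace false

open MeasureTheory Set Filter Topology Metric
open scoped ENNReal NNReal RealInnerProductSpace ContDiff

namespace Summit.NavierStokesRegularity.NavierStokesRegularity.Theorems.PowerGaugeEulerLiouville.SwirlCapacity

open Literature.Analysis Literature.Analysis.FluidPDE

/-! ### The pointwise lever `‖∇Γ‖ ≤ 2 r ‖∇v‖` -/

/-- **`‖∇Γ(x)‖ ≤ 2 r ‖∇v(x)‖` for an axisymmetric field.**  `DΓ(x)h = ⟪Jx, Dv(x)h⟫ + ⟪Jh, v(x)⟫`, `⟪Jh, v(x)⟫ = −⟪J v(x), h⟫ = −⟪Dv(x)(Jx), h⟫`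
(infinitesimal axisymmetry), and `‖Jx‖ = r = cylRadius x`. [folklore] -/
theorem norm_fderiv_swirl_le {v : EuclideanSpace ℝ (Fin 3) → EuclideanSpace ℝ (Fin 3)} (hv : IsAxisymmetric v)
    {x : EuclideanSpace ℝ (Fin 3)} (hd : DifferentiableAt ℝ v x) :
    ‖fderiv ℝ (swirl v) x‖ ≤ 2 * cylRadius x * ‖fderiv ℝ v x‖ := by
  have hr0 : 0 ≤ cylRadius x := cylRadius_nonneg x
  refine ContinuousLinearMap.opNorm_le_bound _ (by positivity) fun h => ?_
  rw [fderiv_swirl_apply hd h]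
  have hJ : rotGen (v x) = fderiv ℝ v x (rotGen x) := (hv.fderiv_rotGen hd).symm
  have hr : ‖rotGen x‖ = cylRadius x := by rw [norm_rotGen]; rfl
  have h1 : |⟪rotGen x, fderiv ℝ v x h⟫| ≤ cylRadius x * (‖fderiv ℝ v x‖ * ‖h‖) :=
    calc |⟪rotGen x, fderiv ℝ v x h⟫| ≤ ‖rotGen x‖ * ‖fderiv ℝ v x h‖ := abs_real_inner_le_norm _ _
      _ ≤ cylRadius x * (‖fderiv ℝ v x‖ * ‖h‖) := by
          rw [hr]
          exact mul_le_mul_of_nonneg_left (ContinuousLinearMap.le_opNorm _ _) hr0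
  have h2e : ⟪rotGen h, v x⟫ = -⟪fderiv ℝ v x (rotGen x), h⟫ := by
    rw [← hJ, inner_rotGen_left, inner_rotGen_left]
    ring
  have h2 : |⟪rotGen h, v x⟫| ≤ cylRadius x * (‖fderiv ℝ v x‖ * ‖h‖) := by
    rw [h2e, abs_neg]
    calc |⟪fderiv ℝ v x (rotGen x), h⟫| ≤ ‖fderiv ℝ v x (rotGen x)‖ * ‖h‖ := abs_real_inner_le_norm _ _
      _ ≤ ‖fderiv ℝ v x‖ * ‖rotGen x‖ * ‖h‖ :=
          mul_le_mul_of_nonneg_right (ContinuousLinearMap.le_opNorm _ _) (norm_nonneg _)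
      _ = cylRadius x * (‖fderiv ℝ v x‖ * ‖h‖) := by rw [hr]; ring
  calc ‖⟪rotGen x, fderiv ℝ v x h⟫ + ⟪rotGen h, v x⟫‖
      = |⟪rotGen x, fderiv ℝ v x h⟫ + ⟪rotGen h, v x⟫| := Real.norm_eq_abs _
    _ ≤ |⟪rotGen x, fderiv ℝ v x h⟫| + |⟪rotGen h, v x⟫| := abs_add_le _ _
    _ ≤ cylRadius x * (‖fderiv ℝ v x‖ * ‖h‖) + cylRadius x * (‖fderiv ℝ v x‖ * ‖h‖) := add_le_add h1 h2
    _ = 2 * cylRadius x * ‖fderiv ℝ v x‖ * ‖h‖ := by ring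

/-- **`‖∇Γ(x)‖²/r² ≤ 4 ‖∇v(x)‖_F²`** (square the lever, compare operator and Frobenius norms — tree `norm_sq_le_frobeniusNormSq`; on the
axis the left side is the junk value `0`). [folklore] -/
theorem norm_fderiv_swirl_sq_div_le {v : EuclideanSpace ℝ (Fin 3) → EuclideanSpace ℝ (Fin 3)} (hv : IsAxisymmetric v)
    {x : EuclideanSpace ℝ (Fin 3)} (hd : DifferentiableAt ℝ v x) :
    ‖fderiv ℝ (swirl v) x‖ ^ 2 / cylRadius x ^ 2 ≤ 4 * frobeniusNormSq (fderiv ℝ v x) := by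
  have h := norm_fderiv_swirl_le hv hd
  have hF := norm_sq_le_frobeniusNormSq (fderiv ℝ v x)
  have hF0 := frobeniusNormSq_nonneg (fderiv ℝ v x)
  by_cases hr : cylRadius x = 0
  · rw [hr]
    simp only [ne_eq, OfNat.ofNat_ne_zero, not_false_eq_true, zero_pow, div_zero]
    positivity
  · have hr0 : 0 < cylRadius x := lt_of_le_of_ne (cylRadius_nonneg x) (Ne.symm hr)
    rw [div_le_iff₀ (by positivity)]
    calc ‖fderiv ℝ (swirl v) x‖ ^ 2 ≤ (2 * cylRadius x * ‖fderiv ℝ v x‖) ^ 2 :=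
          pow_le_pow_left₀ (norm_nonneg _) h 2
      _ = 4 * ‖fderiv ℝ v x‖ ^ 2 * cylRadius x ^ 2 := by ring
      _ ≤ 4 * frobeniusNormSq (fderiv ℝ v x) * cylRadius x ^ 2 :=
          mul_le_mul_of_nonneg_right (mul_le_mul_of_nonneg_left hF (by norm_num)) (sq_nonneg _)

/-! ### The stub, unfolded -/

/-- **D2′ `stub_swirlCapacityFloor` of the line `swirl-capacity`, signature unfolded** (`AxisCapacityFloor`, `SwirlCapacityFloor` are the
line's `def`s): the axis capacity floor for axisymmetric scalars vanishing on the axis implies the swirl capacity floor for axisymmetric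
fields, with constant `K′ = K/(4(1 + log 2))` — sign split of `T` by the sign of `Γ` (one half has volume `≥ V/2`), the floor applied to
`f = ±Γ`, the pointwise lever `‖∇Γ‖²/r² ≤ 4‖∇v‖_F²`, and `1 + log⁺(2A³/V) ≤ (1 + log 2)(1 + log⁺(A³/V))`. [folklore] -/
theorem swirlCapacityFloor_of_axisCapacityFloor :
    (∃ K : ℝ, 0 < K ∧ ∀ (f : EuclideanSpace ℝ (Fin 3) → ℝ) (T : Set (EuclideanSpace ℝ (Fin 3))) (A V γ₀ : ℝ),
      ContDiff ℝ 1 f → IsAxisymmetricScalar f →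
      (∀ x : EuclideanSpace ℝ (Fin 3), cylRadius x = 0 → f x = 0) → 0 < A → 0 < V → 0 < γ₀ → MeasurableSet T →
      T ⊆ ball (0 : EuclideanSpace ℝ (Fin 3)) A →
      ENNReal.ofReal V ≤ volume T → (∀ x ∈ T, γ₀ ≤ f x) →
        ENNReal.ofReal (K * γ₀ ^ 2 / (A * (1 + max 0 (Real.log (A ^ 3 / V))))) ≤
          ∫⁻ x in ball (0 : EuclideanSpace ℝ (Fin 3)) (3 * A),
            ENNReal.ofReal (‖fderiv ℝ f x‖ ^ 2 / cylRadius x ^ 2)) →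
    (∃ K : ℝ, 0 < K ∧ ∀ (v : EuclideanSpace ℝ (Fin 3) → EuclideanSpace ℝ (Fin 3))
      (T : Set (EuclideanSpace ℝ (Fin 3))) (A V γ₀ : ℝ), ContDiff ℝ 1 v → IsAxisymmetric v →
      0 < A → 0 < V → 0 < γ₀ → MeasurableSet T → T ⊆ ball (0 : EuclideanSpace ℝ (Fin 3)) A →
      ENNReal.ofReal V ≤ volume T → (∀ x ∈ T, γ₀ ≤ |swirl v x|) →
        ENNReal.ofReal (K * γ₀ ^ 2 / (A * (1 + max 0 (Real.log (A ^ 3 / V))))) ≤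
          ∫⁻ x in ball (0 : EuclideanSpace ℝ (Fin 3)) (3 * A), ENNReal.ofReal (frobeniusNormSq (fderiv ℝ v x))) := by
  rintro ⟨K, hK, hfloor⟩
  have hlog2 : 0 < Real.log 2 := Real.log_pos one_lt_two
  have hden : 0 < 4 * (1 + Real.log 2) := by positivity
  refine ⟨K / (4 * (1 + Real.log 2)), div_pos hK hden, ?_⟩
  intro v T A V γ₀ hv1 hax hA hV hγ hT hTA hvol hlevel
  have hvd : Differentiable ℝ v := hv1.differentiable one_ne_zero
  -- GENERIC HALF-STEP: the floor for `f = ±Γ` on a half `T' ⊆ T` of volume `≥ V/2` gives the swirl floor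
  have key : ∀ (f : EuclideanSpace ℝ (Fin 3) → ℝ) (T' : Set (EuclideanSpace ℝ (Fin 3))),
      ContDiff ℝ 1 f → IsAxisymmetricScalar f → (∀ x, cylRadius x = 0 → f x = 0) →
      (∀ x, ‖fderiv ℝ f x‖ = ‖fderiv ℝ (swirl v) x‖) → MeasurableSet T' → T' ⊆ T →
      ENNReal.ofReal (V / 2) ≤ volume T' → (∀ x ∈ T', γ₀ ≤ f x) →
      ENNReal.ofReal (K / (4 * (1 + Real.log 2)) * γ₀ ^ 2 / (A * (1 + max 0 (Real.log (A ^ 3 / V))))) ≤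
        ∫⁻ x in ball (0 : EuclideanSpace ℝ (Fin 3)) (3 * A), ENNReal.ofReal (frobeniusNormSq (fderiv ℝ v x)) := by
    intro f T' hf hfax hf0 hnorm hT' hT'T hvol' hlev'
    have hfl := hfloor f T' A (V / 2) γ₀ hf hfax hf0 hA (by positivity) hγ hT' (hT'T.trans hTA) hvol' hlev'
    -- compare the integrands pointwise
    have hint : ∫⁻ x in ball (0 : EuclideanSpace ℝ (Fin 3)) (3 * A), ENNReal.ofReal (‖fderiv ℝ f x‖ ^ 2 / cylRadius x ^ 2) ≤
        ENNReal.ofReal 4 * ∫⁻ x in ball (0 : EuclideanSpace ℝ (Fin 3)) (3 * A),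
          ENNReal.ofReal (frobeniusNormSq (fderiv ℝ v x)) := by
      rw [← lintegral_const_mul' _ _ ENNReal.ofReal_ne_top]
      refine lintegral_mono fun x => ?_
      rw [← ENNReal.ofReal_mul (by norm_num)]
      refine ENNReal.ofReal_le_ofReal ?_
      rw [hnorm x]
      exact norm_fderiv_swirl_sq_div_le hax (hvd x)
    -- the constants: `1 + log⁺(A³/(V/2)) ≤ (1 + log 2)(1 + log⁺(A³/V))`
    have hL : max 0 (Real.log (A ^ 3 / (V / 2))) ≤ Real.log 2 + max 0 (Real.log (A ^ 3 / V)) := by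
      have hq : 0 < A ^ 3 / V := by positivity
      have e : Real.log (A ^ 3 / (V / 2)) = Real.log 2 + Real.log (A ^ 3 / V) := by
        rw [show A ^ 3 / (V / 2) = 2 * (A ^ 3 / V) by field_simp, Real.log_mul two_ne_zero hq.ne']
      rw [e]
      refine max_le (by positivity) ?_
      linarith [le_max_right 0 (Real.log (A ^ 3 / V))]
    have hL0 : 0 ≤ max 0 (Real.log (A ^ 3 / V)) := le_max_left _ _
    have hreal : 4 * (K / (4 * (1 + Real.log 2)) * γ₀ ^ 2 / (A * (1 + max 0 (Real.log (A ^ 3 / V))))) ≤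
        K * γ₀ ^ 2 / (A * (1 + max 0 (Real.log (A ^ 3 / (V / 2))))) := by
      rw [show 4 * (K / (4 * (1 + Real.log 2)) * γ₀ ^ 2 / (A * (1 + max 0 (Real.log (A ^ 3 / V))))) =
        K * γ₀ ^ 2 / ((1 + Real.log 2) * (A * (1 + max 0 (Real.log (A ^ 3 / V))))) by field_simp]
      refine div_le_div_of_nonneg_left (by positivity) (by positivity) ?_
      have h1 : 1 + max 0 (Real.log (A ^ 3 / (V / 2))) ≤ (1 + Real.log 2) * (1 + max 0 (Real.log (A ^ 3 / V))) := by
        nlinarith [mul_nonneg hlog2.le hL0]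
      calc A * (1 + max 0 (Real.log (A ^ 3 / (V / 2)))) ≤ A * ((1 + Real.log 2) * (1 + max 0 (Real.log (A ^ 3 / V)))) :=
            mul_le_mul_of_nonneg_left h1 hA.le
        _ = (1 + Real.log 2) * (A * (1 + max 0 (Real.log (A ^ 3 / V)))) := by ring
    -- assemble in `ℝ≥0∞` and cancel the factor `4`
    have h4 : ENNReal.ofReal 4 ≠ 0 := (ENNReal.ofReal_pos.2 (by norm_num)).ne'
    have hchain : ENNReal.ofReal 4 *
        ENNReal.ofReal (K / (4 * (1 + Real.log 2)) * γ₀ ^ 2 / (A * (1 + max 0 (Real.log (A ^ 3 / V))))) ≤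
        ENNReal.ofReal 4 * ∫⁻ x in ball (0 : EuclideanSpace ℝ (Fin 3)) (3 * A),
          ENNReal.ofReal (frobeniusNormSq (fderiv ℝ v x)) :=
      calc ENNReal.ofReal 4 *
            ENNReal.ofReal (K / (4 * (1 + Real.log 2)) * γ₀ ^ 2 / (A * (1 + max 0 (Real.log (A ^ 3 / V)))))
          = ENNReal.ofReal (4 * (K / (4 * (1 + Real.log 2)) * γ₀ ^ 2 / (A * (1 + max 0 (Real.log (A ^ 3 / V)))))) :=
            (ENNReal.ofReal_mul (by norm_num)).symm
        _ ≤ ENNReal.ofReal (K * γ₀ ^ 2 / (A * (1 + max 0 (Real.log (A ^ 3 / (V / 2)))))) := ENNReal.ofReal_le_ofReal hreal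
        _ ≤ _ := hfl
        _ ≤ _ := hint
    exact (ENNReal.mul_le_mul_iff_right h4 ENNReal.ofReal_ne_top).1 hchain
  -- THE SIGN SPLIT
  have hcont : Continuous (swirl v) := (contDiff_swirl hv1).continuous
  have hmeasP : MeasurableSet (T ∩ {x | γ₀ ≤ swirl v x}) :=
    hT.inter (measurableSet_le measurable_const hcont.measurable)
  have hmeasM : MeasurableSet (T ∩ {x | γ₀ ≤ -swirl v x}) :=
    hT.inter (measurableSet_le measurable_const hcont.neg.measurable)
  have hcover : T ⊆ (T ∩ {x | γ₀ ≤ swirl v x}) ∪ (T ∩ {x | γ₀ ≤ -swirl v x}) := by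
    intro x hx
    rcases le_abs.1 (hlevel x hx) with h | h
    · exact Or.inl ⟨hx, h⟩
    · exact Or.inr ⟨hx, h⟩
  have hhalf : ENNReal.ofReal (V / 2) ≤ volume (T ∩ {x | γ₀ ≤ swirl v x}) ∨
      ENNReal.ofReal (V / 2) ≤ volume (T ∩ {x | γ₀ ≤ -swirl v x}) := by
    by_contra hcon
    simp only [not_or, not_le] at hcon
    have h1 : volume T ≤ volume (T ∩ {x | γ₀ ≤ swirl v x}) + volume (T ∩ {x | γ₀ ≤ -swirl v x}) :=
      (measure_mono hcover).trans (measure_union_le _ _)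
    have h2 : volume (T ∩ {x | γ₀ ≤ swirl v x}) + volume (T ∩ {x | γ₀ ≤ -swirl v x}) <
        ENNReal.ofReal (V / 2) + ENNReal.ofReal (V / 2) := ENNReal.add_lt_add hcon.1 hcon.2
    rw [← ENNReal.ofReal_add (by positivity) (by positivity), add_halves] at h2
    exact absurd (hvol.trans h1) (not_le.2 h2)
  rcases hhalf with hP | hM
  · -- the positive half: `f = Γ`
    exact key (swirl v) _ (contDiff_swirl hv1) hax.isAxisymmetricScalar_swirl
      (fun x hx => swirl_eq_zero_of_cylRadius_eq_zero v hx) (fun x => rfl) hmeasP inter_subset_left hP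
      (fun x hx => hx.2)
  · -- the negative half: `f = -Γ`
    refine key (fun x => -swirl v x) _ (contDiff_swirl hv1).neg (fun θ x => ?_)
      (fun x hx => by rw [swirl_eq_zero_of_cylRadius_eq_zero v hx, neg_zero]) (fun x => ?_) hmeasM
      inter_subset_left hM (fun x hx => hx.2)
    · simp only [hax.swirl_rotZ θ x]
    · rw [fderiv_fun_neg, norm_neg]

end Summit.NavierStokesRegularity.NavierStokesRegularity.Theorems.PowerGaugeEulerLiouville.SwirlCapacity

end
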